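import Mathlib
import Summits.Ventures.FusionMHD.Models.FluxSurfacePolarRayLevel
import HarnessLib

/-!
# Polar-ray chart, LEVEL direction (II): the `V′`- and `q`-KERNELS, their `s`-derivatives, and the panel pieces of
# `V″ = d²V/dψ²` and `dq/dψ` on an IMPLICIT flux surface

LADDER-GRIDFUSION (F2 item R2 / F1 on the Cerfon–Freidberg rung), cell `gridfusion`, seat `gridfusion-model-7` (g5), 2026-08-27.
Second half of `Models/FluxSurfacePolarRayLevel.lean` (split for the 400-line rule).  That file proves the Leibniz rule across
surfaces `LevelPanel.hasDerivAt_integral` for an arbitrary kernel `k(θ, s)`; this file instantiates it for the two functionals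
Jardin's (8.134) differentiates:
* `volKernel R_c D θ s = (R_c + s cos θ)·s/D(θ, s)` — along the glued radius `V′(u) = 2π ∫₀^{2π} volKernel(θ, ρ_u θ) dθ`
  (`V′ = 2π∮ R dℓ/|∇ψ|`, Jardin (5.29) = Freidberg (6.22) `dV/dψ = 2π∮dℓ/B_p`, with `dℓ/|∇ψ| = ρ dθ/|D_r|` on the polar loop,
  `FluxSurfacePolarRay.loopIntegralE_eq_polar`); `volKernelDs` = its `s`-derivative for a supplied second ray derivative
  `D₁ = ∂_s D` (in an instance the Hessian form `ψ_RR cos²θ + 2ψ_RZ sin θ cos θ + ψ_ZZ sin²θ`, a code list like `D`);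
* the Tube file's `polarKernel R_c D θ s = s/((R_c + s cos θ)·D)` (`q(u) = (F/2π)∫₀^{2π} polarKernel(θ, ρ_u θ) dθ`, Freidberg
  (6.35), ★ #88 / ★ #117) and `polarKernelDs`;
* **`LevelPanel.hasDerivAt_volIntegral`**, **`LevelPanel.hasDerivAt_polarIntegral`**: the panel pieces of `V″(u₀)/(2π)` and of
  `(2π/F)·q′(u₀)` ARE the θ-integrals of `volKernelDs/D`, `polarKernelDs/D` along `ρ_{u₀}` (so `Φ″ = 2π q′` and the shear
  `Λ = −Ψ′²q′` of (8.134) on an implicit surface are program-lane objects: «two more top registers», F2-SCOPING v1.5 §9(d)).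
* `LevelPanel.kernel_integral_envelope` / `LevelPanel.kernel_integral_tube`: the Tube file's link machinery (sloped tube from two
  sign facts, resp. residual + slope + tube Lipschitz bound ⇒ `|∫ₐᵇ K(θ, ρ_u θ) − ∫ₐᵇ K(θ, m θ)| ≤ E(b − a)`) for an ARBITRARY
  jointly continuous kernel `K` — so the derivative registers `∫ volKernelDs/D`, `∫ polarKernelDs/D` are enclosed exactly like
  ★ #117's `∫ polarKernel`.
* `LevelPanel.reflect`: for an up–down symmetric flux (`ψ(R, Z_c − t) = ψ(R, Z_c + t)`, `D(2π − θ, s) = D(θ, s)`) a panel on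
  `[a, b]` gives the panel on `[2π − b, 2π − a]` (★ #117 certifies `[0, π]` and reflects).
Elementary calculus, [folklore] for the derivative facts; the kernels carry the printed functional they come from.
MODELLED: nothing.  NOT CLAIMED: any value for any equilibrium; the loop-level bridge to `GradShafranov.volumeDerivE` /
`safetyFactorE` (next file `Models/FluxSurfacePolarRayLevelLoop.lean`).
-/

noncomputable section

open Real Set Filter Topology MeasureTheory intervalIntegral

namespace Summit.Ventures.FusionMHD.Models

namespace PolarRay

/-! ## §3 The two named kernels: `V′` (Jardin (5.29) = Freidberg (6.22)) and `q` (Freidberg (6.35)), their `s`-derivatives,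
and the panel pieces of `V″` and `q′` -/

section kernels

variable {Rc : ℝ} {D D₁ : ℝ → ℝ → ℝ} {θ s : ℝ}

/-- The `V′`-kernel `(R_c + s cos θ)·s/D(θ, s)`: along the glued radius `V′(u) = 2π ∫₀^{2π} volKernel(θ, ρ_u θ) dθ`
(`V′ = 2π∮ R dℓ/|∇ψ|`, Jardin (5.29) = Freidberg (6.22), with `dℓ/|∇ψ| = ρ dθ/|D_r|` on the polar loop). [cite: Jardin2010, §5.3 eq. (5.29)] -/
def volKernel (Rc : ℝ) (D : ℝ → ℝ → ℝ) (θ s : ℝ) : ℝ := (Rc + s * cos θ) * s / D θ s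

/-- `∂_s volKernel = [(R_c + 2s cos θ)·D − (R_c + s cos θ)·s·D₁]/D²` for `D₁ = ∂_s D`. [cite: Jardin2010, §5.3 eq. (5.29)] -/
def volKernelDs (Rc : ℝ) (D D₁ : ℝ → ℝ → ℝ) (θ s : ℝ) : ℝ :=
  ((Rc + 2 * s * cos θ) * D θ s - (Rc + s * cos θ) * s * D₁ θ s) / (D θ s) ^ 2

/-- `∂_s polarKernel = [R_c·D − s·(R_c + s cos θ)·D₁]/((R_c + s cos θ)²·D²)` for the Tube file's `q`-kernel
`polarKernel R_c D θ s = s/((R_c + s cos θ)·D)` and `D₁ = ∂_s D`. [cite: Freidberg2014, §6.3.5 eq. (6.35)] -/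
def polarKernelDs (Rc : ℝ) (D D₁ : ℝ → ℝ → ℝ) (θ s : ℝ) : ℝ :=
  (Rc * D θ s - s * (Rc + s * cos θ) * D₁ θ s) / ((Rc + s * cos θ) ^ 2 * (D θ s) ^ 2)

/-- The `s`-derivative of the `V′`-kernel. [folklore] -/
theorem hasDerivAt_volKernel (hD : HasDerivAt (D θ) (D₁ θ s) s) (hD0 : D θ s ≠ 0) :
    HasDerivAt (volKernel Rc D θ) (volKernelDs Rc D D₁ θ s) s := by
  have h1 : HasDerivAt (fun x => Rc + x * cos θ) (cos θ) s := by
    simpa using ((hasDerivAt_id' s).mul_const (cos θ)).const_add Rc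
  have hnum : HasDerivAt (fun x => (Rc + x * cos θ) * x) (cos θ * s + (Rc + s * cos θ) * 1) s :=
    h1.fun_mul (hasDerivAt_id' s)
  have h := hnum.fun_div hD hD0
  show HasDerivAt (fun x => (Rc + x * cos θ) * x / D θ x) (volKernelDs Rc D D₁ θ s) s
  refine h.congr_deriv ?_
  unfold volKernelDs
  ring

/-- The `s`-derivative of the `q`-kernel (needs `R = R_c + s cos θ ≠ 0`). [folklore] -/
theorem hasDerivAt_polarKernel (hD : HasDerivAt (D θ) (D₁ θ s) s) (hD0 : D θ s ≠ 0) (hR : Rc + s * cos θ ≠ 0) :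
    HasDerivAt (polarKernel Rc D θ) (polarKernelDs Rc D D₁ θ s) s := by
  have h1 : HasDerivAt (fun x => Rc + x * cos θ) (cos θ) s := by
    simpa using ((hasDerivAt_id' s).mul_const (cos θ)).const_add Rc
  have hden : HasDerivAt (fun x => (Rc + x * cos θ) * D θ x) (cos θ * D θ s + (Rc + s * cos θ) * D₁ θ s) s :=
    h1.fun_mul hD
  have h := (hasDerivAt_id' s).fun_div hden (mul_ne_zero hR hD0)
  show HasDerivAt (fun x => x / ((Rc + x * cos θ) * D θ x)) (polarKernelDs Rc D D₁ θ s) s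
  refine h.congr_deriv ?_
  unfold polarKernelDs
  field_simp
  ring

/-- Joint continuity of the `V′`-kernel on a box where `D ≠ 0`. [folklore] -/
theorem continuousOn_volKernel {K : Set (ℝ × ℝ)} (hDc : ContinuousOn (fun p : ℝ × ℝ => D p.1 p.2) K)
    (hD0 : ∀ p ∈ K, D p.1 p.2 ≠ 0) : ContinuousOn (fun p : ℝ × ℝ => volKernel Rc D p.1 p.2) K := by
  unfold volKernel
  exact ContinuousOn.div (by fun_prop) hDc hD0

/-- Joint continuity of `∂_s` of the `V′`-kernel. [folklore] -/
theorem continuousOn_volKernelDs {K : Set (ℝ × ℝ)} (hDc : ContinuousOn (fun p : ℝ × ℝ => D p.1 p.2) K)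
    (hD₁c : ContinuousOn (fun p : ℝ × ℝ => D₁ p.1 p.2) K) (hD0 : ∀ p ∈ K, D p.1 p.2 ≠ 0) :
    ContinuousOn (fun p : ℝ × ℝ => volKernelDs Rc D D₁ p.1 p.2) K := by
  unfold volKernelDs
  refine ContinuousOn.div ?_ (hDc.pow 2) fun p hp => pow_ne_zero 2 (hD0 p hp)
  exact ((by fun_prop : ContinuousOn (fun p : ℝ × ℝ => Rc + 2 * p.2 * cos p.1) K).mul hDc).sub
    ((by fun_prop : ContinuousOn (fun p : ℝ × ℝ => (Rc + p.2 * cos p.1) * p.2) K).mul hD₁c)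

/-- Joint continuity of the `q`-kernel on a box where `D ≠ 0`, `R ≠ 0`. [folklore] -/
theorem continuousOn_polarKernel {K : Set (ℝ × ℝ)} (hDc : ContinuousOn (fun p : ℝ × ℝ => D p.1 p.2) K)
    (hD0 : ∀ p ∈ K, D p.1 p.2 ≠ 0) (hR : ∀ p ∈ K, Rc + p.2 * cos p.1 ≠ 0) :
    ContinuousOn (fun p : ℝ × ℝ => polarKernel Rc D p.1 p.2) K := by
  unfold polarKernel
  exact ContinuousOn.div (by fun_prop) ((by fun_prop : ContinuousOn (fun p : ℝ × ℝ => Rc + p.2 * cos p.1) K).mul hDc)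
    fun p hp => mul_ne_zero (hR p hp) (hD0 p hp)

/-- Joint continuity of `∂_s` of the `q`-kernel. [folklore] -/
theorem continuousOn_polarKernelDs {K : Set (ℝ × ℝ)} (hDc : ContinuousOn (fun p : ℝ × ℝ => D p.1 p.2) K)
    (hD₁c : ContinuousOn (fun p : ℝ × ℝ => D₁ p.1 p.2) K) (hD0 : ∀ p ∈ K, D p.1 p.2 ≠ 0)
    (hR : ∀ p ∈ K, Rc + p.2 * cos p.1 ≠ 0) :
    ContinuousOn (fun p : ℝ × ℝ => polarKernelDs Rc D D₁ p.1 p.2) K := by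
  unfold polarKernelDs
  refine ContinuousOn.div ?_ ?_ fun p hp => mul_ne_zero (pow_ne_zero 2 (hR p hp)) (pow_ne_zero 2 (hD0 p hp))
  · exact ((by fun_prop : ContinuousOn (fun p : ℝ × ℝ => Rc) K).mul hDc).sub
      ((by fun_prop : ContinuousOn (fun p : ℝ × ℝ => p.2 * (Rc + p.2 * cos p.1)) K).mul hD₁c)
  · exact ((by fun_prop : ContinuousOn (fun p : ℝ × ℝ => (Rc + p.2 * cos p.1) ^ 2) K)).mul (hDc.pow 2)

end kernels

namespace LevelPanel

variable {ψ : ℝ → ℝ → ℝ} {Rc Zc a b s₁ s₂ uin uout : ℝ} {D D₁ : ℝ → ℝ → ℝ}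

/-- **THE PANEL PIECE OF `V″`.**  Under the panel hypotheses with level margins and a jointly continuous second ray derivative
`D₁ = ∂_s D` on the box: `d/du|_{u₀} ∫ₐᵇ (R_c + ρ_u cos θ)ρ_u/D dθ = ∫ₐᵇ volKernelDs(θ, ρ_{u₀} θ)/D(θ, ρ_{u₀} θ) dθ`
(so `V″(u₀) = 2π·Σ_panels` of these on a loop covered by panels). [cite: Jardin2010, §5.3 eq. (5.29); §8.5 eq. (8.134)] -/
theorem hasDerivAt_volIntegral (P : LevelPanel ψ Rc Zc a b s₁ s₂ uin uout D) {u₀ : ℝ} (hu₀ : u₀ ∈ Ioo uin uout)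
    (hD₁ : ∀ θ ∈ Icc a b, ∀ s ∈ Icc s₁ s₂, HasDerivAt (D θ) (D₁ θ s) s)
    (hD₁c : ContinuousOn (fun p : ℝ × ℝ => D₁ p.1 p.2) (Icc a b ×ˢ Icc s₁ s₂)) :
    IntervalIntegrable (fun θ => volKernelDs Rc D D₁ θ (rayRadius ψ Rc Zc u₀ θ) / D θ (rayRadius ψ Rc Zc u₀ θ)) volume a b ∧
    HasDerivAt (fun u => ∫ θ in a..b, volKernel Rc D θ (rayRadius ψ Rc Zc u θ))
      (∫ θ in a..b, volKernelDs Rc D D₁ θ (rayRadius ψ Rc Zc u₀ θ) / D θ (rayRadius ψ Rc Zc u₀ θ)) u₀ :=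
  have hD0 : ∀ p ∈ Icc a b ×ˢ Icc s₁ s₂, D p.1 p.2 ≠ 0 := fun p hp => (P.slopePos p.1 hp.1 p.2 hp.2).ne'
  P.hasDerivAt_integral hu₀ (fun θ hθ s hs => hasDerivAt_volKernel (hD₁ θ hθ s hs) (hD0 (θ, s) ⟨hθ, hs⟩))
    (continuousOn_volKernel P.slopeCont hD0) (continuousOn_volKernelDs P.slopeCont hD₁c hD0)

/-- **THE PANEL PIECE OF `q′`.**  Under the panel hypotheses with level margins, `R = R_c + s cos θ > 0` on the box, and a
jointly continuous `D₁ = ∂_s D`: `d/du|_{u₀} ∫ₐᵇ polarIntegrand ψ R_c Z_c u D θ dθ = ∫ₐᵇ polarKernelDs(θ, ρ_{u₀} θ)/D(θ, ρ_{u₀} θ) dθ`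
(so `q′(u₀) = (F/2π)·Σ_panels` on a loop covered by panels; `Φ″ = 2π q′`, `Λ = −Ψ′²q′` in (8.134)).
[cite: Freidberg2014, §6.3.5 eq. (6.35); Jardin2010, §8.5 eq. (8.134)] -/
theorem hasDerivAt_polarIntegral (P : LevelPanel ψ Rc Zc a b s₁ s₂ uin uout D) {u₀ : ℝ} (hu₀ : u₀ ∈ Ioo uin uout)
    (hR : ∀ θ ∈ Icc a b, ∀ s ∈ Icc s₁ s₂, 0 < Rc + s * cos θ)
    (hD₁ : ∀ θ ∈ Icc a b, ∀ s ∈ Icc s₁ s₂, HasDerivAt (D θ) (D₁ θ s) s)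
    (hD₁c : ContinuousOn (fun p : ℝ × ℝ => D₁ p.1 p.2) (Icc a b ×ˢ Icc s₁ s₂)) :
    IntervalIntegrable (fun θ => polarKernelDs Rc D D₁ θ (rayRadius ψ Rc Zc u₀ θ) / D θ (rayRadius ψ Rc Zc u₀ θ)) volume a b ∧
    HasDerivAt (fun u => ∫ θ in a..b, polarIntegrand ψ Rc Zc u D θ)
      (∫ θ in a..b, polarKernelDs Rc D D₁ θ (rayRadius ψ Rc Zc u₀ θ) / D θ (rayRadius ψ Rc Zc u₀ θ)) u₀ := by
  have hD0 : ∀ p ∈ Icc a b ×ˢ Icc s₁ s₂, D p.1 p.2 ≠ 0 := fun p hp => (P.slopePos p.1 hp.1 p.2 hp.2).ne'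
  have hR0 : ∀ p ∈ Icc a b ×ˢ Icc s₁ s₂, Rc + p.2 * cos p.1 ≠ 0 := fun p hp => (hR p.1 hp.1 p.2 hp.2).ne'
  have h := P.hasDerivAt_integral hu₀
    (fun θ hθ s hs => hasDerivAt_polarKernel (hD₁ θ hθ s hs) (hD0 (θ, s) ⟨hθ, hs⟩) (hR0 (θ, s) ⟨hθ, hs⟩))
    (continuousOn_polarKernel P.slopeCont hD0 hR0) (continuousOn_polarKernelDs P.slopeCont hD₁c hD0 hR0)
  simp only [polarIntegrand_eq_polarKernel]
  exact h


/-! ## The link machinery for a GENERAL kernel: envelope and tube forms (so the derivative registers `∫ volKernelDs/D`,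
`∫ polarKernelDs/D` are enclosed exactly like ★ #117's `∫ polarKernel`) -/

/-- **GENERAL-KERNEL ENVELOPE.**  Under the panel hypotheses with level margins, at an admissible level `u`: a sloped tube
`ℓ₁ ≤ ℓ₂` inside the bracket with the two sign facts `ψ(ray ℓ₁ θ) < u < ψ(ray ℓ₂ θ)`, and a pointwise envelope
`g⁻ θ ≤ K(θ, s) ≤ g⁺ θ` on the tube for a jointly continuous kernel `K`, give `∫ₐᵇ g⁻ ≤ ∫ₐᵇ K(θ, ρ_u θ) dθ ≤ ∫ₐᵇ g⁺`
(the Tube file's `panel_integral_envelope` for an arbitrary `K` in place of `polarKernel`). [folklore] -/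
theorem kernel_integral_envelope (P : LevelPanel ψ Rc Zc a b s₁ s₂ uin uout D) {u : ℝ} (hu : u ∈ Ioo uin uout)
    {K : ℝ → ℝ → ℝ} (hKc : ContinuousOn (fun p : ℝ × ℝ => K p.1 p.2) (Icc a b ×ˢ Icc s₁ s₂))
    {ℓ₁ ℓ₂ glo ghi : ℝ → ℝ} (hℓ : ∀ θ ∈ Icc a b, s₁ ≤ ℓ₁ θ ∧ ℓ₁ θ ≤ ℓ₂ θ ∧ ℓ₂ θ ≤ s₂)
    (hsign : ∀ θ ∈ Icc a b, rayProfile ψ Rc Zc θ (ℓ₁ θ) < u ∧ u < rayProfile ψ Rc Zc θ (ℓ₂ θ))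
    (henv : ∀ θ ∈ Icc a b, ∀ s ∈ Icc (ℓ₁ θ) (ℓ₂ θ), glo θ ≤ K θ s ∧ K θ s ≤ ghi θ)
    (hglo : IntervalIntegrable glo volume a b) (hghi : IntervalIntegrable ghi volume a b) :
    (∫ θ in a..b, glo θ) ≤ ∫ θ in a..b, K θ (rayRadius ψ Rc Zc u θ)
      ∧ ∫ θ in a..b, K θ (rayRadius ψ Rc Zc u θ) ≤ ∫ θ in a..b, ghi θ := by
  have hint := P.intervalIntegrable_kernel hKc hu
  have hpt : ∀ θ ∈ Icc a b, glo θ ≤ K θ (rayRadius ψ Rc Zc u θ) ∧ K θ (rayRadius ψ Rc Zc u θ) ≤ ghi θ := by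
    intro θ hθ
    have hρ := rayRadius_mem_Ioo_of_signs_on P.cont P.hs₁ P.hs₁₂ (P.inner_lt hu)
      (fun _ hθ' => P.strictMonoOn_rayProfile hθ') (P.lt_outer hu) hℓ hsign hθ
    exact henv θ hθ _ ⟨hρ.1.le, hρ.2.le⟩
  exact ⟨intervalIntegral.integral_mono_on P.hab hglo hint fun θ hθ => (hpt θ hθ).1,
    intervalIntegral.integral_mono_on P.hab hint hghi fun θ hθ => (hpt θ hθ).2⟩

/-- **GENERAL-KERNEL TUBE FORM** (the certificate vocabulary): an approximant `m` with `[m − r, m + r] ⊆ [s₁, s₂]` on the panel,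
residual `|ψ(ray_θ m θ) − u| ≤ η`, slope `D ≥ μ` on the tube with `rμ > η`, and a tube Lipschitz bound `|K(θ, s) − K(θ, m θ)| ≤ E`
give `|∫ₐᵇ K(θ, ρ_u θ) dθ − ∫ₐᵇ K(θ, m θ) dθ| ≤ E·(b − a)`. [folklore] -/
theorem kernel_integral_tube (P : LevelPanel ψ Rc Zc a b s₁ s₂ uin uout D) {u : ℝ} (hu : u ∈ Ioo uin uout)
    {K : ℝ → ℝ → ℝ} (hKc : ContinuousOn (fun p : ℝ × ℝ => K p.1 p.2) (Icc a b ×ˢ Icc s₁ s₂))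
    {m : ℝ → ℝ} {r η μ E : ℝ} (hr : 0 < r) (hrμ : η < r * μ)
    (hm : ∀ θ ∈ Icc a b, s₁ ≤ m θ - r ∧ m θ + r ≤ s₂)
    (hres : ∀ θ ∈ Icc a b, |rayProfile ψ Rc Zc θ (m θ) - u| ≤ η)
    (hμ : ∀ θ ∈ Icc a b, ∀ s ∈ Icc (m θ - r) (m θ + r), μ ≤ D θ s)
    (hE : ∀ θ ∈ Icc a b, ∀ s ∈ Icc (m θ - r) (m θ + r), |K θ s - K θ (m θ)| ≤ E)
    (hmid : IntervalIntegrable (fun θ => K θ (m θ)) volume a b) :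
    (∫ θ in a..b, K θ (m θ)) - E * (b - a) ≤ ∫ θ in a..b, K θ (rayRadius ψ Rc Zc u θ)
      ∧ ∫ θ in a..b, K θ (rayRadius ψ Rc Zc u θ) ≤ (∫ θ in a..b, K θ (m θ)) + E * (b - a) := by
  have hsub : ∀ θ ∈ Icc a b, ∀ s ∈ Icc (m θ - r) (m θ + r), s ∈ Icc s₁ s₂ :=
    fun θ hθ s hs => ⟨(hm θ hθ).1.trans hs.1, hs.2.trans (hm θ hθ).2⟩
  have hsign : ∀ θ ∈ Icc a b, rayProfile ψ Rc Zc θ (m θ - r) < u ∧ u < rayProfile ψ Rc Zc θ (m θ + r) := fun θ hθ =>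
    signs_of_residual_of_slope (F := rayProfile ψ Rc Zc θ) (F' := D θ) hr hrμ (hres θ hθ)
      (fun s hs => P.slope θ hθ s (hsub θ hθ s hs)) (fun s hs => hμ θ hθ s hs)
  have hℓ : ∀ θ ∈ Icc a b, s₁ ≤ m θ - r ∧ m θ - r ≤ m θ + r ∧ m θ + r ≤ s₂ :=
    fun θ hθ => ⟨(hm θ hθ).1, by linarith, (hm θ hθ).2⟩
  have henv : ∀ θ ∈ Icc a b, ∀ s ∈ Icc (m θ - r) (m θ + r),
      K θ (m θ) - E ≤ K θ s ∧ K θ s ≤ K θ (m θ) + E := by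
    intro θ hθ s hs
    have h := abs_le.1 (hE θ hθ s hs)
    constructor <;> linarith [h.1, h.2]
  have h := P.kernel_integral_envelope hu hKc hℓ hsign henv (hmid.sub intervalIntegrable_const)
    (hmid.add intervalIntegrable_const)
  rw [intervalIntegral.integral_sub hmid intervalIntegrable_const, intervalIntegral.integral_add hmid intervalIntegrable_const,
    intervalIntegral.integral_const, smul_eq_mul] at h
  constructor <;> linarith [h.1, h.2]

end LevelPanel

/-! ## Mirror symmetry: a certified panel on `[a, b]` gives the reflected panel on `[2π − b, 2π − a]`
(★ #117 certifies `θ ∈ [0, π]` and reflects by `U(X, −Y) = U(X, Y)`; with this lemma the reflected half is a `LevelPanel` too) -/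

section reflect

variable {ψ : ℝ → ℝ → ℝ} {Rc Zc a b s₁ s₂ uin uout : ℝ} {D : ℝ → ℝ → ℝ}

/-- For an up–down symmetric flux (`ψ(R, Z_c − t) = ψ(R, Z_c + t)`) the ray profile is invariant under `θ ↦ 2π − θ`. [folklore] -/
theorem rayProfile_two_pi_sub (hsym : ∀ R t : ℝ, ψ R (Zc - t) = ψ R (Zc + t)) (θ s : ℝ) :
    rayProfile ψ Rc Zc (2 * π - θ) s = rayProfile ψ Rc Zc θ s := by
  unfold rayProfile
  rw [cos_two_pi_sub, sin_two_pi_sub, mul_neg, ← sub_eq_add_neg, hsym]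

/-- **THE REFLECTED PANEL.**  For an up–down symmetric flux and a radial-derivative field with `D(2π − θ, s) = D(θ, s)`, the panel
hypotheses with level margins on `[a, b]` transfer verbatim to `[2π − b, 2π − a]` (same bracket, same margins). [folklore] -/
theorem LevelPanel.reflect (P : LevelPanel ψ Rc Zc a b s₁ s₂ uin uout D)
    (hsym : ∀ R t : ℝ, ψ R (Zc - t) = ψ R (Zc + t)) (hD : ∀ θ s : ℝ, D (2 * π - θ) s = D θ s) :
    LevelPanel ψ Rc Zc (2 * π - b) (2 * π - a) s₁ s₂ uin uout D := by
  have hrefl : ∀ θ ∈ Icc (2 * π - b) (2 * π - a), 2 * π - θ ∈ Icc a b :=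
    fun θ hθ => ⟨by linarith [hθ.2], by linarith [hθ.1]⟩
  have hmap : MapsTo (fun p : ℝ × ℝ => (2 * π - p.1, p.2)) (Icc (2 * π - b) (2 * π - a) ×ˢ Icc s₁ s₂)
      (Icc a b ×ˢ Icc s₁ s₂) := fun p hp => ⟨hrefl p.1 hp.1, hp.2⟩
  have hφ : Continuous fun p : ℝ × ℝ => ((2 * π - p.1, p.2) : ℝ × ℝ) := by fun_prop
  -- the profile at θ is the profile at the reflected direction
  have hprof : ∀ θ s : ℝ, rayProfile ψ Rc Zc θ s = rayProfile ψ Rc Zc (2 * π - θ) s := fun θ s => by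
    have h := rayProfile_two_pi_sub (Rc := Rc) hsym (2 * π - θ) s
    rwa [show 2 * π - (2 * π - θ) = θ by ring] at h
  refine
    { hab := by linarith [P.hab]
      hs₁ := P.hs₁
      hs₁₂ := P.hs₁₂
      cont := ?_
      slope := ?_
      slopeCont := ?_
      slopePos := fun θ hθ s hs => by rw [← hD θ s]; exact P.slopePos _ (hrefl θ hθ) s hs
      inner := fun θ hθ s hs0 hss => by rw [hprof θ s]; exact P.inner _ (hrefl θ hθ) s hs0 hss
      outer := fun θ hθ => by rw [hprof θ s₂]; exact P.outer _ (hrefl θ hθ) }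
  · refine (P.cont.comp hφ.continuousOn hmap).congr fun p _ => ?_
    simp only [Function.comp_apply]
    exact hprof p.1 p.2
  · intro θ hθ s hs
    have h := P.slope (2 * π - θ) (hrefl θ hθ) s hs
    have e : rayProfile ψ Rc Zc θ = rayProfile ψ Rc Zc (2 * π - θ) := funext fun s' => hprof θ s'
    rw [e, ← hD θ s]
    exact h
  · refine (P.slopeCont.comp hφ.continuousOn hmap).congr fun p _ => ?_
    simp only [Function.comp_apply]
    exact (hD p.1 p.2).symm

end reflect


end PolarRay

end Summit.Ventures.FusionMHD.Models

end
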